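import Summits.CriticalPhenomena.PercolationContinuityZ3.Theorems.PercNearOneGluingNoHeavyLowerTailSahiThreeCopyTwoPoint

/-!
# `NoHeavyLowerTail` (crux stmt-CriticalPhenomena-4575), Sahi programme: **THE TWO-POINT (SANDWICH) CERTIFICATE DOES NOT EXIST IN
# GENERAL** — for the read-once slot `C₈ = (x₀∨x₁)(x₂∨x₃)(x₄∨x₅)(x₆∨x₇)` at the front profile `π ≡ 1` NO weight `θ ≥ 0` satisfies the
# hypotheses (N1), (N2) of the two-point reduction `tc_frontFn_nonneg_of_upSets` / `tc_frontFn_nonneg_of_twoPoint` (`…SahiThreeCopyTwoPoint`)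

Support file (Sahi cell, seat `prim-sahi-p1`, generation 60; `--supports stmt-CriticalPhenomena-4575`).  COMPUTATIONAL: the sixteen
integer constants of §3 and the pointwise count of §4 are evaluated by `native_decide` (sums over `{0,1}^8 × {0,1}^8`, 65 536 terms each);
everything else uses standard axioms.

CONTEXT.  Generation 59 reduced 3C-SAHI for a first slot `F = frontFn f` (an up-set `f` of the front `k`-cube, the other two slots
ARBITRARY in every dimension) to the existence of a "two-point certificate" `θ ≥ 0` with (N1), (N2) nonnegative on all pairs of up-set
indicators (`tc_frontFn_nonneg_of_upSets`), verified its existence by exact LP for every up-set on `≤ 5` coordinates, proved it in Lean for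
`≤ 4` coordinates, and conjectured that such a certificate exists for every `(f, π)` (memo FROM-prim-sahi-p1-gen59 §12, "TP₀").
THIS FILE REFUTES THAT CONJECTURE: ★★★ `not_twoPoint_C8` — for `k = 8`, `π ≡ 1`, `f = 1_{C₈}` the hypotheses are contradictory.
(Found by an exact symmetric-orbit LP, memo FROM-prim-sahi-p1-gen60; the smallest failure is `(x₀∨x₁)(x₂∨x₃)(x₄∨x₅∨x₆)` at `k = 7`;
`C₆ = (x₀∨x₁)(x₂∨x₃)(x₄∨x₅)` still has a certificate.)  NOTHING is claimed about 3C-SAHI itself: either 3C-SAHI fails for some triple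
`(C₈, G, H)` in dimension `≥ 9`, or the two-point reduction is strictly lossy; which of the two holds is open (no counterexample to 3C
was found with `F = C₈` and `≤ 3` back coordinates).

THE ARGUMENT (a 16-row Farkas certificate, human-checkable).  Write `T_θ(w) = Σ_arr θ(e₁,e₂,e₃)·w(e₁)` (linear, monotone in `w ≥ 0` for
`θ ≥ 0`), `c(Z) = 2·#tok{e₁ ∈ Z} − #tok{e₂ ∈ Z}` and `R(V,W) = #tok{e₁∈V,e₃∈W} + #tok{e₂∈V,e₁∈W} − #tok{e₂∈V,e₃∈W}` (tokens = arrangements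
with `e₁ ∈ C₈`).  Then (N1) at `(1_Z, 1)` reads `T_θ(1_Z) ≤ c(Z)` and (N2) at `(1_V,1_W)` reads `T_θ(1_{V∩W}) ≥ R(V,W)` (§1: `N1form_split`,
`N2form_split`; §3: the constants).  Pairs `p = {a_p, b_p}` of `C₈`, `j(e)` = number of pairs contained in the level `e`.  Rows:
(N1) at `Z = L` (`c = 625`), `Z = {top}` (`c = 2`), `Z = Z_{pq} = ↑(a_pb_pa_qb_q)` for the six `p < q` (`c = 50` each): total `927`;
(N2) at `(V_T, L)`, `V_T = ↑(three full pairs)` for the four triples `T` (`R = 5` each) and at `(↑b_p, ↑a_p)` for the four pairs (`R = 250`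
each — these pairs are 3C-TIGHT): total `1020`.  Pointwise `1 + [j=4] + C(j,2) ≥ C(j,3) + j` for `j = 0,…,4` (§4, `dominate_C8`), so
`Σ_{N2 rows} T_θ ≤ Σ_{N1 rows} T_θ ≤ 927 < 1020 ≤ Σ_{N2 rows} T_θ` — contradiction.  [this work]
-/

namespace Summit.CriticalPhenomena.PercolationContinuityZ3.Theorems.SahiThreeCopy

open Finset Function Literature.Combinatorics.Sahi2008
open scoped BigOperators

/-! ### §1 Splitting off the `θ`-part of (N1), (N2); collapsing the third copy of an arrangement -/

section General

variable {k : ℕ}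

/-- The `θ`-part of both forms: `T_θ(w) = Σ_arr θ(e₁,e₂,e₃)·w(e₁)`. [this work] -/
noncomputable def thetaLin (π : Fin k → ℕ) (θ : Pt k → Pt k → Pt k → ℝ) (w : Pt k → ℝ) : ℝ :=
  ∑ σ : Pt k × Pt k × Pt k, arrInd π σ.1 σ.2.1 σ.2.2 * (θ σ.1 σ.2.1 σ.2.2 * w σ.1)

/-- `T_θ` is additive in the weight. [this work] -/
theorem thetaLin_add (π : Fin k → ℕ) (θ : Pt k → Pt k → Pt k → ℝ) (w w' : Pt k → ℝ) :
    thetaLin π θ (w + w') = thetaLin π θ w + thetaLin π θ w' := by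
  unfold thetaLin; rw [← sum_add_distrib]; exact sum_congr rfl fun σ _ => by simp only [Pi.add_apply]; ring

/-- `T_θ` of a finite sum of weights. [this work] -/
theorem thetaLin_sum {ι : Type*} (π : Fin k → ℕ) (θ : Pt k → Pt k → Pt k → ℝ) (s : Finset ι) (w : ι → Pt k → ℝ) :
    ∑ i ∈ s, thetaLin π θ (w i) = thetaLin π θ (∑ i ∈ s, w i) := by
  classical
  induction s using Finset.induction_on with
  | empty => simp [thetaLin]
  | insert a s ha ih => rw [sum_insert ha, sum_insert ha, thetaLin_add, ih]

/-- `T_θ` is monotone in the weight when `θ ≥ 0`. [this work] -/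
theorem thetaLin_mono (π : Fin k → ℕ) {θ : Pt k → Pt k → Pt k → ℝ} (hθ : ∀ e₁ e₂ e₃, 0 ≤ θ e₁ e₂ e₃) {w w' : Pt k → ℝ}
    (hw : ∀ e, w e ≤ w' e) : thetaLin π θ w ≤ thetaLin π θ w' := by
  unfold thetaLin
  exact sum_le_sum fun σ _ => mul_le_mul_of_nonneg_left (mul_le_mul_of_nonneg_left (hw _) (hθ _ _ _)) (arrInd_nonneg π _ _ _)

/-- (N1) = its `θ`-free part minus `T_θ(φψ)`. [this work] -/
theorem N1form_split (π : Fin k → ℕ) (f : Pt k → ℝ) (θ : Pt k → Pt k → Pt k → ℝ) (φ ψ : Pt k → ℝ) :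
    N1form k π f θ φ ψ = N1form k π f (fun _ _ _ => 0) φ ψ - thetaLin π θ (φ * ψ) := by
  unfold N1form thetaLin; rw [← sum_sub_distrib]
  exact sum_congr rfl fun σ _ => by simp only [Pi.mul_apply]; ring

/-- (N2) = its `θ`-free part plus `T_θ(φψ)`. [this work] -/
theorem N2form_split (π : Fin k → ℕ) (f : Pt k → ℝ) (θ : Pt k → Pt k → Pt k → ℝ) (φ ψ : Pt k → ℝ) :
    N2form k π f θ φ ψ = N2form k π f (fun _ _ _ => 0) φ ψ + thetaLin π θ (φ * ψ) := by
  unfold N2form thetaLin; rw [← sum_add_distrib]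
  exact sum_congr rfl fun σ _ => by simp only [Pi.mul_apply]; ring

/-- The third copy of an arrangement is determined by the first two: `z_i = π_i − x_i − y_i`. [this work] -/
def zOf (π : Fin k → ℕ) (x y : Pt k) : Pt k := fun i => decide (π i = (x i).toNat + (y i).toNat + 1)

/-- An arrangement's third point is `zOf`. [this work] -/
theorem eq_zOf_of_isArr {π : Fin k → ℕ} {x y z : Pt k} (h : IsArr π x y z) : z = zOf π x y := by
  funext i
  have hi := h i
  unfold zOf
  cases hz : z i
  · rw [hz] at hi; simp only [Bool.toNat_false, add_zero] at hi
    symm; rw [decide_eq_false_iff_not]; omega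
  · rw [hz] at hi; simp only [Bool.toNat_true] at hi
    symm; rw [decide_eq_true_iff]; omega

/-- Collapsing the sum over the third copy: `Σ_{x,y,z} [arr] g = Σ_{x,y} [arr(x,y,zOf)] g(x,y,zOf)`. [this work] -/
theorem sum_arrInd_collapse (π : Fin k → ℕ) (g : Pt k → Pt k → Pt k → ℝ) :
    ∑ σ : Pt k × Pt k × Pt k, arrInd π σ.1 σ.2.1 σ.2.2 * g σ.1 σ.2.1 σ.2.2 =
      ∑ x : Pt k, ∑ y : Pt k, arrInd π x y (zOf π x y) * g x y (zOf π x y) := by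
  rw [Fintype.sum_prod_type]
  refine sum_congr rfl fun x _ => ?_
  rw [Fintype.sum_prod_type]
  refine sum_congr rfl fun y _ => ?_
  rw [Finset.sum_eq_single (zOf π x y)]
  · intro z _ hz
    have : ¬ IsArr π x y z := fun h => hz (eq_zOf_of_isArr h)
    simp [arrInd, this]
  · intro h; exact absurd (mem_univ _) h

/-- Indicator of a Boolean predicate, as the `setInd` of its filter. [this work] -/
theorem setInd_filter_eq (P : Pt k → Bool) (e : Pt k) : setInd (univ.filter fun x => P x = true) e = if P e = true then 1 else 0 := by
  rw [setInd_apply]; simp only [mem_filter, mem_univ, true_and]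

/-- A filter by a Boolean predicate that is monotone along the coordinatewise order is an up-set. [this work] -/
theorem isUpperSet_filter_bool {P : Pt k → Bool} (hP : ∀ x y : Pt k, x ≤ y → P x = true → P y = true) :
    IsUpperSet ((univ.filter fun x => P x = true : Finset (Pt k)) : Set (Pt k)) := by
  intro x y hxy hx
  simp only [coe_filter, mem_univ, true_and, Set.mem_setOf_eq] at hx ⊢
  exact hP x y hxy hx

/-- `θ`-free part of (N1) on Boolean indicators, computed over pairs `(x,y)` (integer mirror for `native_decide`). [this work] -/
def c0Z (π : Fin k → ℕ) (fB PV PW : Pt k → Bool) : ℤ :=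
  ∑ x : Pt k, ∑ y : Pt k, if IsArr π x y (zOf π x y) then
    (2 * (if fB x then 1 else 0) * (if PV x then 1 else 0) * (if PW x then 1 else 0)
      - (if fB x then 1 else 0) * (if PV y then 1 else 0) * (if PW y then 1 else 0)) else 0

/-- `θ`-free part of (N2) on Boolean indicators, computed over pairs `(x,y)` (integer mirror for `native_decide`). [this work] -/
def r0Z (π : Fin k → ℕ) (fB PV PW : Pt k → Bool) : ℤ :=
  ∑ x : Pt k, ∑ y : Pt k, if IsArr π x y (zOf π x y) then
    ((if fB x then 1 else 0) * (if PV y then 1 else 0) * (if PW (zOf π x y) then 1 else 0)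
      - (if fB y then 1 else 0) * (if PV x then 1 else 0) * (if PW y then 1 else 0)
      - (if fB y then 1 else 0) * (if PV y then 1 else 0) * (if PW x then 1 else 0)) else 0

/-- Bridge: the `θ`-free (N1) on filtered indicators is the integer `c0Z`. [this work] -/
theorem N1form_zero_eq_c0Z (π : Fin k → ℕ) (fB PV PW : Pt k → Bool) :
    N1form k π (setInd (univ.filter fun x => fB x = true)) (fun _ _ _ => 0)
        (setInd (univ.filter fun x => PV x = true)) (setInd (univ.filter fun x => PW x = true)) = (c0Z π fB PV PW : ℝ) := by
  unfold N1form c0Z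
  rw [sum_arrInd_collapse π (fun a b c => (2 * setInd (univ.filter fun x => fB x = true) a - 0) *
      (setInd (univ.filter fun x => PV x = true) a * setInd (univ.filter fun x => PW x = true) a)
      - setInd (univ.filter fun x => fB x = true) a *
        (setInd (univ.filter fun x => PV x = true) b * setInd (univ.filter fun x => PW x = true) b))]
  push_cast
  refine sum_congr rfl fun x _ => sum_congr rfl fun y _ => ?_
  simp only [arrInd, setInd_filter_eq]
  by_cases h : IsArr π x y (zOf π x y)
  · simp only [h, if_true, one_mul, sub_zero]
    cases fB x <;> cases PV x <;> cases PW x <;> cases PV y <;> cases PW y <;> simp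
  · simp [h]

/-- Bridge: the `θ`-free (N2) on filtered indicators is the integer `r0Z`. [this work] -/
theorem N2form_zero_eq_r0Z (π : Fin k → ℕ) (fB PV PW : Pt k → Bool) :
    N2form k π (setInd (univ.filter fun x => fB x = true)) (fun _ _ _ => 0)
        (setInd (univ.filter fun x => PV x = true)) (setInd (univ.filter fun x => PW x = true)) = (r0Z π fB PV PW : ℝ) := by
  unfold N2form r0Z
  rw [sum_arrInd_collapse π (fun a b c => 0 * (setInd (univ.filter fun x => PV x = true) a * setInd (univ.filter fun x => PW x = true) a)
      + setInd (univ.filter fun x => fB x = true) a *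
        (setInd (univ.filter fun x => PV x = true) b * setInd (univ.filter fun x => PW x = true) c)
      - setInd (univ.filter fun x => fB x = true) b *
        (setInd (univ.filter fun x => PV x = true) a * setInd (univ.filter fun x => PW x = true) b)
      - setInd (univ.filter fun x => fB x = true) b *
        (setInd (univ.filter fun x => PV x = true) b * setInd (univ.filter fun x => PW x = true) a))]
  push_cast
  refine sum_congr rfl fun x _ => sum_congr rfl fun y _ => ?_
  simp only [arrInd, setInd_filter_eq]
  by_cases h : IsArr π x y (zOf π x y)
  · simp only [h, if_true, one_mul, zero_mul, zero_add]
    cases fB x <;> cases fB y <;> cases PV x <;> cases PV y <;> cases PW x <;> cases PW y <;> cases PW (zOf π x y) <;> simp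
  · simp [h]

/-- (N1) at filtered indicators, split: `θ`-free integer part minus `T_θ`. [this work] -/
theorem N1form_filter_eq (π : Fin k → ℕ) (θ : Pt k → Pt k → Pt k → ℝ) (fB PV PW : Pt k → Bool) :
    N1form k π (setInd (univ.filter fun x => fB x = true)) θ
        (setInd (univ.filter fun x => PV x = true)) (setInd (univ.filter fun x => PW x = true)) =
      (c0Z π fB PV PW : ℝ) - thetaLin π θ (setInd (univ.filter fun x => PV x = true) * setInd (univ.filter fun x => PW x = true)) := by
  rw [N1form_split, N1form_zero_eq_c0Z]

/-- (N2) at filtered indicators, split: `θ`-free integer part plus `T_θ`. [this work] -/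
theorem N2form_filter_eq (π : Fin k → ℕ) (θ : Pt k → Pt k → Pt k → ℝ) (fB PV PW : Pt k → Bool) :
    N2form k π (setInd (univ.filter fun x => fB x = true)) θ
        (setInd (univ.filter fun x => PV x = true)) (setInd (univ.filter fun x => PW x = true)) =
      (r0Z π fB PV PW : ℝ) + thetaLin π θ (setInd (univ.filter fun x => PV x = true) * setInd (univ.filter fun x => PW x = true)) := by
  rw [N2form_split, N2form_zero_eq_r0Z]

end General

/-! ### §2 The instance: `k = 8`, `π ≡ 1`, `C₈ = (x₀∨x₁)(x₂∨x₃)(x₄∨x₅)(x₆∨x₇)`, cylinders -/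

/-- The front profile `π ≡ 1` on eight coordinates. [this work] -/
def piOne8 : Fin 8 → ℕ := fun _ => 1

/-- `C₈ = (x₀∨x₁)(x₂∨x₃)(x₄∨x₅)(x₆∨x₇)` as a Boolean function of the level. [this work] -/
def c8B (e : Pt 8) : Bool := (e 0 || e 1) && (e 2 || e 3) && (e 4 || e 5) && (e 6 || e 7)

/-- The cylinder `↑S = {e : e_i = 1 for all i ∈ S}` as a Boolean predicate (`S` given as a list of coordinates). [this work] -/
def cylB (S : List (Fin 8)) (e : Pt 8) : Bool := S.all fun i => e i

/-- The up-set `C₈` of the front cube `{0,1}^8`. [this work] -/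
def C8set : Finset (Pt 8) := univ.filter fun e => c8B e = true

/-- The cylinder `↑S` as a `Finset` of levels. [this work] -/
def cyl (S : List (Fin 8)) : Finset (Pt 8) := univ.filter fun e => cylB S e = true

/-- Cylinders are up-sets. [this work] -/
theorem isUpperSet_cyl (S : List (Fin 8)) : IsUpperSet ((cyl S : Finset (Pt 8)) : Set (Pt 8)) := by
  refine isUpperSet_filter_bool fun x y hxy hx => ?_
  simp only [cylB, List.all_eq_true] at hx ⊢
  intro i hi
  have h1 := hx i hi
  have h2 : x i ≤ y i := hxy i
  revert h1 h2; cases x i <;> cases y i <;> simp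

/-! ### §3 The sixteen constants (computational) -/

/-- `c(L) = 625` (= the number of tokens). [this work] -/
theorem c0Z_all : c0Z piOne8 c8B (cylB []) (cylB []) = 625 := by native_decide
/-- `c({top}) = 2`. [this work] -/
theorem c0Z_top : c0Z piOne8 c8B (cylB [0, 1, 2, 3, 4, 5, 6, 7]) (cylB []) = 2 := by native_decide
/-- `c(Z_{01}) = 50`. [this work] -/
theorem c0Z_Z01 : c0Z piOne8 c8B (cylB [0, 1, 2, 3]) (cylB []) = 50 := by native_decide
/-- `c(Z_{02}) = 50`. [this work] -/
theorem c0Z_Z02 : c0Z piOne8 c8B (cylB [0, 1, 4, 5]) (cylB []) = 50 := by native_decide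
/-- `c(Z_{03}) = 50`. [this work] -/
theorem c0Z_Z03 : c0Z piOne8 c8B (cylB [0, 1, 6, 7]) (cylB []) = 50 := by native_decide
/-- `c(Z_{12}) = 50`. [this work] -/
theorem c0Z_Z12 : c0Z piOne8 c8B (cylB [2, 3, 4, 5]) (cylB []) = 50 := by native_decide
/-- `c(Z_{13}) = 50`. [this work] -/
theorem c0Z_Z13 : c0Z piOne8 c8B (cylB [2, 3, 6, 7]) (cylB []) = 50 := by native_decide
/-- `c(Z_{23}) = 50`. [this work] -/
theorem c0Z_Z23 : c0Z piOne8 c8B (cylB [4, 5, 6, 7]) (cylB []) = 50 := by native_decide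
/-- `−R(V_{012}, L) = −5`. [this work] -/
theorem r0Z_V012 : r0Z piOne8 c8B (cylB [0, 1, 2, 3, 4, 5]) (cylB []) = -5 := by native_decide
/-- `−R(V_{013}, L) = −5`. [this work] -/
theorem r0Z_V013 : r0Z piOne8 c8B (cylB [0, 1, 2, 3, 6, 7]) (cylB []) = -5 := by native_decide
/-- `−R(V_{023}, L) = −5`. [this work] -/
theorem r0Z_V023 : r0Z piOne8 c8B (cylB [0, 1, 4, 5, 6, 7]) (cylB []) = -5 := by native_decide
/-- `−R(V_{123}, L) = −5`. [this work] -/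
theorem r0Z_V123 : r0Z piOne8 c8B (cylB [2, 3, 4, 5, 6, 7]) (cylB []) = -5 := by native_decide
/-- `−R(↑x₁, ↑x₀) = −250` (a 3C-tight pair). [this work] -/
theorem r0Z_p0 : r0Z piOne8 c8B (cylB [1]) (cylB [0]) = -250 := by native_decide
/-- `−R(↑x₃, ↑x₂) = −250`. [this work] -/
theorem r0Z_p1 : r0Z piOne8 c8B (cylB [3]) (cylB [2]) = -250 := by native_decide
/-- `−R(↑x₅, ↑x₄) = −250`. [this work] -/
theorem r0Z_p2 : r0Z piOne8 c8B (cylB [5]) (cylB [4]) = -250 := by native_decide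
/-- `−R(↑x₇, ↑x₆) = −250`. [this work] -/
theorem r0Z_p3 : r0Z piOne8 c8B (cylB [7]) (cylB [6]) = -250 := by native_decide

/-! ### §4 Pointwise domination of the (N2) weights by the (N1) weights, and the refutation -/

/-- The indicator product weight of a row `(V, W) = (↑S, ↑S')`. [this work] -/
noncomputable def wRow (S S' : List (Fin 8)) : Pt 8 → ℝ := setInd (cyl S) * setInd (cyl S')

/-- The eight (N1) rows `(Z, L)`: `Z = L`, `{top}`, and the six `Z_{pq}`. [this work] -/
def rowsN1 : List (List (Fin 8) × List (Fin 8)) :=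
  [([], []), ([0, 1, 2, 3, 4, 5, 6, 7], []), ([0, 1, 2, 3], []), ([0, 1, 4, 5], []), ([0, 1, 6, 7], []), ([2, 3, 4, 5], []),
   ([2, 3, 6, 7], []), ([4, 5, 6, 7], [])]

/-- The eight (N2) rows: `(V_T, L)` for the four triples of pairs, `(↑b_p, ↑a_p)` for the four pairs. [this work] -/
def rowsN2 : List (List (Fin 8) × List (Fin 8)) :=
  [([0, 1, 2, 3, 4, 5], []), ([0, 1, 2, 3, 6, 7], []), ([0, 1, 4, 5, 6, 7], []), ([2, 3, 4, 5, 6, 7], []),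
   ([1], [0]), ([3], [2]), ([5], [4]), ([7], [6])]

/-- Boolean count of rows containing a level. [this work] -/
def rowCount (rows : List (List (Fin 8) × List (Fin 8))) (e : Pt 8) : ℕ :=
  (rows.filter fun r => cylB r.1 e && cylB r.2 e).length

/-- ★ The pointwise domination `#{(N2) rows ∋ e} ≤ #{(N1) rows ∋ e}` at every level `e` (i.e. `C(j,3) + j ≤ 1 + [j=4] + C(j,2)` in the
number `j` of full pairs). [this work] -/
theorem dominate_C8 : ∀ e : Pt 8, rowCount rowsN2 e ≤ rowCount rowsN1 e := by native_decide

/-- The weight sum of a row list at a level equals the row count. [this work] -/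
theorem sum_wRow_eq (rows : List (List (Fin 8) × List (Fin 8))) (e : Pt 8) :
    (rows.map fun r => wRow r.1 r.2 e).sum = (rowCount rows e : ℝ) := by
  induction rows with
  | nil => simp [rowCount]
  | cons r rs ih =>
    simp only [List.map_cons, List.sum_cons, ih, rowCount, List.filter_cons]
    have h1 : wRow r.1 r.2 e = if (cylB r.1 e && cylB r.2 e) = true then 1 else 0 := by
      simp only [wRow, Pi.mul_apply, cyl, setInd_filter_eq, Bool.and_eq_true]
      by_cases ha : cylB r.1 e = true <;> by_cases hb : cylB r.2 e = true <;> simp [ha, hb]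
    rw [h1]
    split_ifs with h
    · simp only [List.length_cons]; push_cast; ring
    · simp

/-- `T_θ` summed over a row list. [this work] -/
theorem thetaLin_rows (θ : Pt 8 → Pt 8 → Pt 8 → ℝ) (rows : List (List (Fin 8) × List (Fin 8))) :
    (rows.map fun r => thetaLin piOne8 θ (wRow r.1 r.2)).sum = thetaLin piOne8 θ (fun e => (rowCount rows e : ℝ)) := by
  induction rows with
  | nil =>
    simp only [List.map_nil, List.sum_nil, rowCount, List.filter_nil, List.length_nil, Nat.cast_zero]
    simp [thetaLin]
  | cons r rs ih =>
    rw [List.map_cons, List.sum_cons, ih, ← thetaLin_add]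
    congr 1
    funext e
    have := sum_wRow_eq (r :: rs) e
    rw [List.map_cons, List.sum_cons, sum_wRow_eq] at this
    simpa only [Pi.add_apply] using this

/-- ★★★ **NO TWO-POINT CERTIFICATE FOR `C₈` AT `π ≡ 1`.**  The hypotheses of `tc_frontFn_nonneg_of_upSets` (the SANDWICH / TP₀ certificate
of memo gen59: `θ ≥ 0` with (N1), (N2) nonnegative on all pairs of up-set indicators) are unsatisfiable for `k = 8`, `π ≡ 1`,
`f = 1_{C₈}`, `C₈ = (x₀∨x₁)(x₂∨x₃)(x₄∨x₅)(x₆∨x₇)`.  Hence the two-point route cannot prove 3C-SAHI for this slot, and the conjecture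
"TP₀ holds for every `(f, π)`" (memo gen59 §12) is false. [this work] -/
theorem not_twoPoint_C8 :
    ¬ ∃ θ : Pt 8 → Pt 8 → Pt 8 → ℝ, (∀ e₁ e₂ e₃, 0 ≤ θ e₁ e₂ e₃) ∧
      (∀ V W : Finset (Pt 8), IsUpperSet (V : Set (Pt 8)) → IsUpperSet (W : Set (Pt 8)) →
        0 ≤ N1form 8 piOne8 (setInd C8set) θ (setInd V) (setInd W)) ∧
      (∀ V W : Finset (Pt 8), IsUpperSet (V : Set (Pt 8)) → IsUpperSet (W : Set (Pt 8)) →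
        0 ≤ N2form 8 piOne8 (setInd C8set) θ (setInd V) (setInd W)) := by
  rintro ⟨θ, hθ, h1, h2⟩
  -- the sixteen instantiated rows, in split form
  have row1 : ∀ S : List (Fin 8), thetaLin piOne8 θ (wRow S []) ≤ (c0Z piOne8 c8B (cylB S) (cylB []) : ℝ) := by
    intro S
    have h := h1 (cyl S) (cyl []) (isUpperSet_cyl S) (isUpperSet_cyl [])
    unfold C8set cyl at h; rw [N1form_filter_eq] at h
    unfold wRow cyl; linarith
  have row2 : ∀ S S' : List (Fin 8), -(r0Z piOne8 c8B (cylB S) (cylB S') : ℝ) ≤ thetaLin piOne8 θ (wRow S S') := by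
    intro S S'
    have h := h2 (cyl S) (cyl S') (isUpperSet_cyl S) (isUpperSet_cyl S')
    unfold C8set cyl at h; rw [N2form_filter_eq] at h
    unfold wRow cyl; linarith
  -- upper bound 927 for the (N1) rows
  have hU : (rowsN1.map fun r => thetaLin piOne8 θ (wRow r.1 r.2)).sum ≤ 927 := by
    simp only [rowsN1, List.map_cons, List.map_nil, List.sum_cons, List.sum_nil]
    have a0 := row1 []; have a1 := row1 [0, 1, 2, 3, 4, 5, 6, 7]; have a2 := row1 [0, 1, 2, 3]; have a3 := row1 [0, 1, 4, 5]
    have a4 := row1 [0, 1, 6, 7]; have a5 := row1 [2, 3, 4, 5]; have a6 := row1 [2, 3, 6, 7]; have a7 := row1 [4, 5, 6, 7]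
    rw [c0Z_all] at a0; rw [c0Z_top] at a1; rw [c0Z_Z01] at a2; rw [c0Z_Z02] at a3; rw [c0Z_Z03] at a4; rw [c0Z_Z12] at a5
    rw [c0Z_Z13] at a6; rw [c0Z_Z23] at a7
    push_cast at a0 a1 a2 a3 a4 a5 a6 a7
    linarith
  -- lower bound 1020 for the (N2) rows
  have hL : (1020 : ℝ) ≤ (rowsN2.map fun r => thetaLin piOne8 θ (wRow r.1 r.2)).sum := by
    simp only [rowsN2, List.map_cons, List.map_nil, List.sum_cons, List.sum_nil]
    have b0 := row2 [0, 1, 2, 3, 4, 5] []; have b1 := row2 [0, 1, 2, 3, 6, 7] []; have b2 := row2 [0, 1, 4, 5, 6, 7] []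
    have b3 := row2 [2, 3, 4, 5, 6, 7] []; have b4 := row2 [1] [0]; have b5 := row2 [3] [2]; have b6 := row2 [5] [4]
    have b7 := row2 [7] [6]
    rw [r0Z_V012] at b0; rw [r0Z_V013] at b1; rw [r0Z_V023] at b2; rw [r0Z_V123] at b3; rw [r0Z_p0] at b4; rw [r0Z_p1] at b5
    rw [r0Z_p2] at b6; rw [r0Z_p3] at b7
    push_cast at b0 b1 b2 b3 b4 b5 b6 b7
    linarith
  -- domination: Σ_{N2 rows} T_θ ≤ Σ_{N1 rows} T_θ
  have hD : (rowsN2.map fun r => thetaLin piOne8 θ (wRow r.1 r.2)).sum ≤ (rowsN1.map fun r => thetaLin piOne8 θ (wRow r.1 r.2)).sum := by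
    rw [thetaLin_rows, thetaLin_rows]
    exact thetaLin_mono piOne8 hθ fun e => by exact_mod_cast dominate_C8 e
  linarith

/-- Corollary: the FUNCTION-form hypotheses of `tc_frontFn_nonneg_of_twoPoint` ((N1), (N2) for all pairs of nonnegative monotone level
functions) are unsatisfiable for `(C₈, π ≡ 1)` as well. [this work] -/
theorem not_twoPoint_C8_fun :
    ¬ ∃ θ : Pt 8 → Pt 8 → Pt 8 → ℝ, (∀ e₁ e₂ e₃, 0 ≤ θ e₁ e₂ e₃) ∧
      (∀ φ ψ : Pt 8 → ℝ, (∀ e, 0 ≤ φ e) → (∀ e, 0 ≤ ψ e) → Monotone φ → Monotone ψ →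
        0 ≤ N1form 8 piOne8 (setInd C8set) θ φ ψ) ∧
      (∀ φ ψ : Pt 8 → ℝ, (∀ e, 0 ≤ φ e) → (∀ e, 0 ≤ ψ e) → Monotone φ → Monotone ψ →
        0 ≤ N2form 8 piOne8 (setInd C8set) θ φ ψ) := by
  rintro ⟨θ, hθ, h1, h2⟩
  exact not_twoPoint_C8 ⟨θ, hθ,
    fun V W hV hW => h1 _ _ (setInd_nonneg V) (setInd_nonneg W) (monotone_setInd hV) (monotone_setInd hW),
    fun V W hV hW => h2 _ _ (setInd_nonneg V) (setInd_nonneg W) (monotone_setInd hV) (monotone_setInd hW)⟩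

end Summit.CriticalPhenomena.PercolationContinuityZ3.Theorems.SahiThreeCopy
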